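import Mathlib
import HarnessLib
import Summits.ValiantsHypothesis.ValiantsHypothesis.Theses.MonotoneRestoration
import Literature.Computability.AlgebraicComplexity.ArithCircuit
import Literature.Computability.AlgebraicComplexity.ArithCircuitProofs
import Literature.Computability.AlgebraicComplexity.MonotoneStructure
import Literature.Computability.AlgebraicComplexity.PermanentIrreducible
import Literature.ModelTheory.FiniteModelTheory.CkEquiv
import Summits.ValiantsHypothesis.ValiantsHypothesis.Theorems.MonotoneRestorationMonotoneRestorationQPCosetCount
import Summits.ValiantsHypothesis.ValiantsHypothesis.Theorems.MonotoneRestorationMonotoneRestorationQPSymmetricLB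
import Summits.ValiantsHypothesis.ValiantsHypothesis.Theorems.MonotoneRestorationMonotoneRestorationQPSupportSymmetrisation
import Summits.ValiantsHypothesis.ValiantsHypothesis.Theorems.MonotoneRestorationMonotoneRestorationQPSparseRegime
import Summits.ValiantsHypothesis.ValiantsHypothesis.Theorems.MonotoneRestorationMonotoneRestorationQPBeta
import Literature.Computability.AlgebraicComplexity.SymmetricArithCircuit
import Literature.Computability.AlgebraicComplexity.DawarWilsenach2025Proofs
import Literature.GroupTheory.PermutationGroups.SmallIndexSubgroups
import Summits.ValiantsHypothesis.ValiantsHypothesis.Theorems.MonotoneRestorationQP.Negative.LoadBearing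
import Summits.ValiantsHypothesis.ValiantsHypothesis.Theorems.MonotoneRestorationMonotoneRestorationQPPermSupportCount

/-! TTRL-lite variant V19341 of stmt-ValiantsHypothesis-15886

Step 0 of the symmetric lower-bound argument: the polynomial computed at the single output of a
`Sym_n`-symmetric labelled arithmetic circuit over `ℝ≥0` on the variable matrix `Fin n × Fin n`
is invariant under the diagonal renaming `x_{ij} ↦ x_{ρ i, ρ j}` — the output gate is fixed by
every extending automorphism (Dawar–Wilsenach, remark after Def. 3.7;
`IsSymmetric.rename_eval_output_unit`).
-/

-- `Summit.ValiantsHypothesis.ValiantsHypothesis.…` is the tree's mandated single-conjunct layout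
-- (Sub = Summit), so the duplicated namespace component is intended.
set_option linter.dupNamespace false

namespace Summit.ValiantsHypothesis.ValiantsHypothesis.Theorems

open Summit.ValiantsHypothesis.ValiantsHypothesis.Theses.MonotoneRestoration
open Literature.Computability.AlgebraicComplexity

/-- **TTRL-lite variant V19341 of `stub_symmetricMonotone_choose_le_card`** (step 0: the output
polynomial of a symmetric single-output circuit is symmetric). For a `Sym_n`-symmetric labelled
arithmetic circuit `C` over `ℝ≥0` on the variables `Fin n × Fin n` with one output, and every
`ρ ∈ Sym_n`, renaming the variables diagonally by `ρ` fixes `C.eval (C.output ())`: the unique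
output index is fixed by `ρ`, so this is `IsSymmetric.rename_eval_output_unit` for the
componentwise action `ρ • (i, j) = (ρ i, ρ j)`.
[cite: DawarWilsenach2025, §3.2 (after Def. 3.7)] -/
theorem stub_symmetricMonotone_choose_le_card_var19341 :
    ∀ (n : ℕ) (G : Type) (C : LabelledArithCircuit NNReal (Fin n × Fin n) Unit G),
      C.IsSymmetric (Equiv.Perm (Fin n)) → ∀ ρ : Equiv.Perm (Fin n),
        MvPolynomial.rename (fun p : Fin n × Fin n => (ρ p.1, ρ p.2)) (C.eval (C.output ())) =
          C.eval (C.output ()) := by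
  intro n G C hC ρ
  exact hC.rename_eval_output_unit ρ

end Summit.ValiantsHypothesis.ValiantsHypothesis.Theorems
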